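import Summits.QuantumFields.YangMills.Theorems.VirialFluxGapAnchorChartTransversal
import Summits.QuantumFields.YangMills.Theorems.VirialFluxGapAnchorChartMeasure
import HarnessLib

/-!
# The two-anchor DENSITY `anchorDensity`: positivity, continuity, smoothness near the base point
# (layer (B2) of the DIRECT Laplace road to ⟨stmt-QuantumFields-24204⟩ `VirialFluxGap.SharpTwistedLaplace`)

Helper module (free-hands work of width seat ym-line-sfw-p2-w3 g57, cell ym-idea-1; `--supports 24204`).  Sequel of
✓`VirialFluxGapAnchorChartTransversal`.  The density `J = anchorDensity = |det D(anchorCoord)| · w_exp ⊗ w_exp` of the anchor-core chart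
identity (✓`haar_prod_restrict_image_anchorMap`) is the `J` of ✓`OrbitTubeMeasure.restrict_tube_eq_map_withDensity_ofReal` and enters the
window datum `j(y) = (∫_Φ J(z,y) dz)/c` of ✓`QuantitativeLaplace.laplaceMethod_quantitative_orbit_tube`.  This file supplies its qualitative
properties — all constants here are UNIVERSAL (they depend on nothing: no `L`, no `z`, no sign class):
* §1 `anchorDensity_nonneg`, `measurable_anchorDensity`, `continuousAt_anchorDensity` (on `‖a‖ < 1`), ★ `anchorDensity_zero_pos`
  (non-zero Jacobian ✓`det_fderiv_anchorCoord_zero_ne_zero` and `w_exp > 0` inside the chart ball), `exists_ball_anchorDensity_pos`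
  (a neighbourhood of the base point on which `J ≥ J(0)/2 > 0`), `exists_bound_anchorDensity` (bounded on compact windows);
* §2 `contDiff_clm_det` (the determinant is a smooth function of a continuous linear endomorphism of a finite-dimensional space — Leibniz
  expansion in a basis), `contDiffAt_expWeight` (`w_exp` is smooth away from `0`), ★ `contDiffAt_anchorDensity` (`J` is `C^∞` at every window
  point where the Jacobian does not vanish, in particular near the base point: `exists_ball_contDiffAt_anchorDensity`).
Everything here is PROVED; no definitions, no named facts (namespace `Summit.QuantumFields.YangMills.Theorems.VirialFluxGap.AnchorSlice`).
HONEST FRAMING: finite-dimensional calculus; ⟨24204⟩, ⟨24319⟩ and every rung stay OPEN; the Yang–Mills mass gap (Clay) is NOT touched; no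
summit is proved by a line.

## References
* K. W. Breitung, *Asymptotic Approximations for Probability Integrals*, LNM 1592 (1994), §2.3 Definitions 4–5; Lemma 7 p. 12. [Breitung1994]
* G. E. Bredon, *Introduction to Compact Transformation Groups* (1972), Ch. II §§4–5. [Bredon1972]
-/

set_option autoImplicit false

noncomputable section

open scoped Quaternion RealInnerProductSpace
open NormedSpace MeasureTheory Set Filter Topology
open Literature.MathematicalPhysics.QuantumLattice
open Literature.MathematicalPhysics.QuantumFieldTheory.Balaban1983to89
open Literature.MathematicalPhysics.QuantumFieldTheory.Balaban1983to89.T4HaarSU2ExpChart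
open Literature.MathematicalPhysics.QuantumFieldTheory.Balaban1983to89.T4ExpWindowSmallField
open Literature.MathematicalPhysics.QuantumFieldTheory.Balaban1983to89.B15Prop1ChartCalculusSU2
open Literature.MathematicalPhysics.QuantumFieldTheory.Balaban1983to89.T4HaarSU2Translate (su2Quat_mul su2Quat_one continuous_su2Quat)
open Summit.QuantumFields.YangMills.Theorems.FemtoTransferGap

namespace Summit.QuantumFields.YangMills.Theorems.VirialFluxGap.AnchorSlice

section Det

variable {P : Type*} [NormedAddCommGroup P] [NormedSpace ℝ P] [FiniteDimensional ℝ P]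

/-- **The determinant is a smooth function of a continuous linear endomorphism** of a finite-dimensional real normed space (Leibniz
expansion in a basis: a polynomial in finitely many continuous linear functionals of the map). [folklore] -/
theorem contDiff_clm_det {n : WithTop ℕ∞} : ContDiff ℝ n fun f : P →L[ℝ] P => f.det := by
  classical
  set b := Module.finBasis ℝ P with hb
  have hdet : ∀ f : P →L[ℝ] P, f.det = ∑ σ : Equiv.Perm (Fin (Module.finrank ℝ P)),
      (Equiv.Perm.sign σ : ℝ) * ∏ i, b.repr (f (b i)) (σ i) := by
    intro f
    rw [ContinuousLinearMap.det, ← LinearMap.det_toMatrix b, Matrix.det_apply']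
    refine Finset.sum_congr rfl fun σ _ => ?_
    congr 1
    refine Finset.prod_congr rfl fun i _ => ?_
    rw [LinearMap.toMatrix_apply]
    rfl
  have heq : (fun f : P →L[ℝ] P => f.det) = fun f => ∑ σ : Equiv.Perm (Fin (Module.finrank ℝ P)),
      (Equiv.Perm.sign σ : ℝ) * ∏ i, b.repr (f (b i)) (σ i) := funext hdet
  rw [heq]
  refine ContDiff.sum fun σ _ => contDiff_const.mul (contDiff_prod fun i _ => ?_)
  -- `f ↦ b.repr (f (b i)) (σ i)` is a continuous linear functional of `f`
  have h1 : ContDiff ℝ n fun f : P →L[ℝ] P => f (b i) := (ContinuousLinearMap.apply ℝ P (b i)).contDiff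
  have h2 : ContDiff ℝ n fun v : P => b.repr v (σ i) :=
    ((Finsupp.lapply (σ i)).comp (b.repr : P →ₗ[ℝ] (Fin (Module.finrank ℝ P) →₀ ℝ))).toContinuousLinearMap.contDiff
  exact h2.comp h1

end Det

section Anchors

variable {ωC ωN ωX : EuclideanSpace ℝ (Fin 3)} {C₀ N₀ : SU2}

/-! ## §1 Positivity, measurability, continuity -/

/-- `anchorDensity ≥ 0`. [folklore] -/
theorem anchorDensity_nonneg (w : EuclideanSpace ℝ (Fin 3) × EuclideanSpace ℝ (Fin 3)) : 0 ≤ anchorDensity ωC ωN ωX C₀ N₀ w := by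
  unfold anchorDensity
  exact mul_nonneg (abs_nonneg _) (mul_nonneg (expWeight_nonneg _) (expWeight_nonneg _))

/-- `anchorDensity` is measurable. [folklore] -/
theorem measurable_anchorDensity : Measurable (anchorDensity ωC ωN ωX C₀ N₀) := by
  unfold anchorDensity
  exact ((ContinuousLinearMap.continuous_det.measurable.comp (measurable_fderiv ℝ (anchorCoord ωC ωN ωX C₀ N₀))).abs).mul
    ((measurable_expWeight.comp measurable_anchorCoord.fst).mul (measurable_expWeight.comp measurable_anchorCoord.snd))

/-- `anchorDensity` is continuous at every window point `‖a‖ < 1`. [folklore] -/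
theorem continuousAt_anchorDensity (hC : ‖ωC‖ = 1) (hN : ‖ωN‖ = 1) (hCN : ⟪ωC, ωN⟫ = 0) (hX : imQuat ωX = imQuat ωC * imQuat ωN)
    (hC₀ : su2Quat C₀ = imQuat ωC) (hN₀ : su2Quat N₀ = imQuat ωN ∨ su2Quat N₀ = -imQuat ωN)
    {w : EuclideanSpace ℝ (Fin 3) × EuclideanSpace ℝ (Fin 3)} (hw : ‖w.2‖ < 1) :
    ContinuousAt (anchorDensity ωC ωN ωX C₀ N₀) w := by
  have hsm : ContDiffAt ℝ 1 (anchorCoord ωC ωN ωX C₀ N₀) w := contDiffAt_anchorCoord hC hN hCN hX hC₀ hN₀ hw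
  have hfd : ContinuousAt (fderiv ℝ (anchorCoord ωC ωN ωX C₀ N₀)) w :=
    (hsm.fderiv_right (m := 0) le_rfl).continuousAt
  have hco : ContinuousAt (anchorCoord ωC ωN ωX C₀ N₀) w := hsm.continuousAt
  unfold anchorDensity
  exact ((ContinuousLinearMap.continuous_det.continuousAt.comp hfd).abs).mul
    (((continuous_expWeight.continuousAt.comp (continuousAt_fst.comp hco))).mul
      ((continuous_expWeight.continuousAt.comp (continuousAt_snd.comp hco))))

/-- ★ **The density is positive at the base point**: non-zero Jacobian (✓`det_fderiv_anchorCoord_zero_ne_zero`) and `w_exp > 0` on the chart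
ball. [cite: Breitung1994, §2.3 Definitions 4–5] -/
theorem anchorDensity_zero_pos (hC : ‖ωC‖ = 1) (hN : ‖ωN‖ = 1) (hCN : ⟪ωC, ωN⟫ = 0) (hX : imQuat ωX = imQuat ωC * imQuat ωN)
    (hC₀ : su2Quat C₀ = imQuat ωC) (hN₀ : su2Quat N₀ = imQuat ωN ∨ su2Quat N₀ = -imQuat ωN) :
    0 < anchorDensity ωC ωN ωX C₀ N₀ 0 := by
  have hdet := det_fderiv_anchorCoord_zero_ne_zero hC hN hCN hX hC₀ hN₀
  have hmem := anchorCoord_mem_ball hC hN hCN hX hC₀ hN₀ (w := 0) (by rw [Prod.snd_zero, norm_zero]; exact one_pos)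
  unfold anchorDensity
  exact mul_pos (abs_pos.2 hdet) (mul_pos (expWeight_pos hmem.1) (expWeight_pos hmem.2))

/-- **A neighbourhood of the base point on which the density stays above half its base value.** [folklore] -/
theorem exists_ball_anchorDensity_ge (hC : ‖ωC‖ = 1) (hN : ‖ωN‖ = 1) (hCN : ⟪ωC, ωN⟫ = 0) (hX : imQuat ωX = imQuat ωC * imQuat ωN)
    (hC₀ : su2Quat C₀ = imQuat ωC) (hN₀ : su2Quat N₀ = imQuat ωN ∨ su2Quat N₀ = -imQuat ωN) :
    ∃ δ : ℝ, 0 < δ ∧ ∀ w : EuclideanSpace ℝ (Fin 3) × EuclideanSpace ℝ (Fin 3), ‖w‖ < δ →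
      anchorDensity ωC ωN ωX C₀ N₀ 0 / 2 ≤ anchorDensity ωC ωN ωX C₀ N₀ w := by
  have h0 := anchorDensity_zero_pos hC hN hCN hX hC₀ hN₀
  have hcont := continuousAt_anchorDensity hC hN hCN hX hC₀ hN₀ (w := 0) (by rw [Prod.snd_zero, norm_zero]; exact one_pos)
  have hev : ∀ᶠ w in 𝓝 (0 : EuclideanSpace ℝ (Fin 3) × EuclideanSpace ℝ (Fin 3)),
      anchorDensity ωC ωN ωX C₀ N₀ 0 / 2 < anchorDensity ωC ωN ωX C₀ N₀ w :=
    hcont.eventually (lt_mem_nhds (by linarith))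
  obtain ⟨δ, hδ, hball⟩ := Metric.eventually_nhds_iff.1 hev
  exact ⟨δ, hδ, fun w hw => (hball (by simpa [dist_zero_right] using hw)).le⟩

/-- **The density is bounded on compact windows** `closedBall 0 r × closedBall 0 R`, `R < 1`. [folklore] -/
theorem exists_bound_anchorDensity (hC : ‖ωC‖ = 1) (hN : ‖ωN‖ = 1) (hCN : ⟪ωC, ωN⟫ = 0) (hX : imQuat ωX = imQuat ωC * imQuat ωN)
    (hC₀ : su2Quat C₀ = imQuat ωC) (hN₀ : su2Quat N₀ = imQuat ωN ∨ su2Quat N₀ = -imQuat ωN) (r : ℝ) {R : ℝ} (hR : R < 1) :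
    ∃ M : ℝ, ∀ w ∈ Metric.closedBall (0 : EuclideanSpace ℝ (Fin 3)) r ×ˢ Metric.closedBall (0 : EuclideanSpace ℝ (Fin 3)) R,
      anchorDensity ωC ωN ωX C₀ N₀ w ≤ M := by
  set W := Metric.closedBall (0 : EuclideanSpace ℝ (Fin 3)) r ×ˢ Metric.closedBall (0 : EuclideanSpace ℝ (Fin 3)) R
  have hWc : IsCompact W := (isCompact_closedBall 0 r).prod (isCompact_closedBall 0 R)
  have hcont : ContinuousOn (anchorDensity ωC ωN ωX C₀ N₀) W := by
    refine continuousOn_of_forall_continuousAt fun w hw => continuousAt_anchorDensity hC hN hCN hX hC₀ hN₀ ?_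
    exact lt_of_le_of_lt (by simpa using hw.2) hR
  obtain ⟨M, hM⟩ := hWc.exists_bound_of_continuousOn hcont
  exact ⟨M, fun w hw => (le_abs_self _).trans ((Real.norm_eq_abs _).symm.le.trans (hM w hw))⟩

/-! ## §2 Smoothness near the base point -/

/-- `w_exp = (2π²)⁻¹ sinc²‖·‖` is smooth away from the origin. [folklore] -/
theorem contDiffAt_expWeight {x : EuclideanSpace ℝ (Fin 3)} (hx : x ≠ 0) {n : WithTop ℕ∞} : ContDiffAt ℝ n expWeight x := by
  have hev : (fun y : EuclideanSpace ℝ (Fin 3) => (2 * Real.pi ^ 2)⁻¹ * (Real.sin ‖y‖ / ‖y‖) ^ 2) =ᶠ[𝓝 x] expWeight := by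
    have hopen : IsOpen {y : EuclideanSpace ℝ (Fin 3) | y ≠ 0} := isOpen_ne
    filter_upwards [hopen.mem_nhds hx] with y hy
    rw [expWeight, Real.sinc_of_ne_zero (norm_ne_zero_iff.2 hy)]
  refine ContDiffAt.congr_of_eventuallyEq ?_ hev.symm
  have hn : ContDiffAt ℝ n (fun y : EuclideanSpace ℝ (Fin 3) => ‖y‖) x := contDiffAt_norm ℝ hx
  exact contDiffAt_const.mul (((Real.contDiff_sin.contDiffAt.comp x hn).div hn (norm_ne_zero_iff.2 hx)).pow 2)

/-- The exponential coordinates of the two anchors do not vanish on the window `‖a‖ < 1` (their norms are `arccos` of real parts of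
modulus `< 1`). [folklore] -/
theorem anchorCoord_ne_zero (hC : ‖ωC‖ = 1) (hN : ‖ωN‖ = 1) (hCN : ⟪ωC, ωN⟫ = 0) (hX : imQuat ωX = imQuat ωC * imQuat ωN)
    (hC₀ : su2Quat C₀ = imQuat ωC) (hN₀ : su2Quat N₀ = imQuat ωN ∨ su2Quat N₀ = -imQuat ωN)
    {w : EuclideanSpace ℝ (Fin 3) × EuclideanSpace ℝ (Fin 3)} (hw : ‖w.2‖ < 1) :
    (anchorCoord ωC ωN ωX C₀ N₀ w).1 ≠ 0 ∧ (anchorCoord ωC ωN ωX C₀ N₀ w).2 ≠ 0 := by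
  have key : ∀ q : ℍ, |q.re| < 1 → logVec q ≠ 0 := by
    intro q hq h
    have h1 : ‖logVec q‖ = 0 := by rw [h, norm_zero]
    rw [norm_logVec] at h1
    have h2 : Real.arccos q.re = 0 ↔ 1 ≤ q.re := Real.arccos_eq_zero
    have := h2.1 h1
    linarith [(abs_lt.mp hq).2]
  constructor
  · apply key
    rw [re_anchor_fst hC hC₀, abs_neg]
    have h1 : |w.2 0| < 1 := lt_of_le_of_lt (by simpa using PiLp.norm_apply_le w.2 0) hw
    rcases eq_or_ne (w.2 0) 0 with h | h
    · rw [h, Real.sin_zero, abs_zero]; exact one_pos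
    · exact (Real.abs_sin_lt_abs h).trans h1
  · apply key
    rw [re_anchor_snd hC hN hCN hX hN₀, abs_mul]
    have hs : |Real.sinc ‖(w.2 1) • ωN + (w.2 2) • ωX‖| ≤ 1 := Real.abs_sinc_le_one _
    have h1 : |w.2 1| < 1 := lt_of_le_of_lt (by simpa using PiLp.norm_apply_le w.2 1) hw
    calc |Real.sinc ‖(w.2 1) • ωN + (w.2 2) • ωX‖| * |w.2 1| ≤ 1 * |w.2 1| := mul_le_mul_of_nonneg_right hs (abs_nonneg _)
      _ < 1 := by rw [one_mul]; exact h1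

/-- ★ **`anchorDensity` is `C^∞` at every window point where the Jacobian does not vanish.** [cite: Breitung1994, §2.3 Definitions 4–5] -/
theorem contDiffAt_anchorDensity (hC : ‖ωC‖ = 1) (hN : ‖ωN‖ = 1) (hCN : ⟪ωC, ωN⟫ = 0) (hX : imQuat ωX = imQuat ωC * imQuat ωN)
    (hC₀ : su2Quat C₀ = imQuat ωC) (hN₀ : su2Quat N₀ = imQuat ωN ∨ su2Quat N₀ = -imQuat ωN) {n : ℕ∞}
    {w : EuclideanSpace ℝ (Fin 3) × EuclideanSpace ℝ (Fin 3)} (hw : ‖w.2‖ < 1)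
    (hdet : (fderiv ℝ (anchorCoord ωC ωN ωX C₀ N₀) w).det ≠ 0) :
    ContDiffAt ℝ n (anchorDensity ωC ωN ωX C₀ N₀) w := by
  have hsm : ContDiffAt ℝ ((n : WithTop ℕ∞) + 1) (anchorCoord ωC ωN ωX C₀ N₀) w := contDiffAt_anchorCoord hC hN hCN hX hC₀ hN₀ hw
  have hfd : ContDiffAt ℝ n (fderiv ℝ (anchorCoord ωC ωN ωX C₀ N₀)) w := hsm.fderiv_right le_rfl
  have hco : ContDiffAt ℝ n (anchorCoord ωC ωN ωX C₀ N₀) w := hsm.of_le le_self_add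
  obtain ⟨h1, h2⟩ := anchorCoord_ne_zero hC hN hCN hX hC₀ hN₀ hw
  unfold anchorDensity
  refine (((contDiffAt_abs hdet).comp w (contDiff_clm_det.contDiffAt.comp w hfd))).mul
    (((contDiffAt_expWeight h1).comp w (contDiffAt_fst.comp w hco)).mul ((contDiffAt_expWeight h2).comp w (contDiffAt_snd.comp w hco)))

/-- **A neighbourhood of the base point on which the density is `C^∞`** (the Jacobian stays non-zero near `0` by continuity).
[cite: Breitung1994, §2.3 Definitions 4–5] -/
theorem exists_ball_contDiffAt_anchorDensity (hC : ‖ωC‖ = 1) (hN : ‖ωN‖ = 1) (hCN : ⟪ωC, ωN⟫ = 0)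
    (hX : imQuat ωX = imQuat ωC * imQuat ωN) (hC₀ : su2Quat C₀ = imQuat ωC)
    (hN₀ : su2Quat N₀ = imQuat ωN ∨ su2Quat N₀ = -imQuat ωN) {n : ℕ∞} :
    ∃ δ : ℝ, 0 < δ ∧ δ ≤ 1 ∧ ∀ w : EuclideanSpace ℝ (Fin 3) × EuclideanSpace ℝ (Fin 3), ‖w‖ < δ →
      (fderiv ℝ (anchorCoord ωC ωN ωX C₀ N₀) w).det ≠ 0 ∧ ContDiffAt ℝ n (anchorDensity ωC ωN ωX C₀ N₀) w := by
  have hw0 : ‖(0 : EuclideanSpace ℝ (Fin 3) × EuclideanSpace ℝ (Fin 3)).2‖ < 1 := by rw [Prod.snd_zero, norm_zero]; exact one_pos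
  have hsm : ContDiffAt ℝ 1 (anchorCoord ωC ωN ωX C₀ N₀) 0 := contDiffAt_anchorCoord hC hN hCN hX hC₀ hN₀ hw0
  have hfd : ContinuousAt (fun w => (fderiv ℝ (anchorCoord ωC ωN ωX C₀ N₀) w).det) 0 :=
    ContinuousLinearMap.continuous_det.continuousAt.comp (hsm.fderiv_right (m := 0) le_rfl).continuousAt
  have hne := det_fderiv_anchorCoord_zero_ne_zero hC hN hCN hX hC₀ hN₀
  have hev : ∀ᶠ w in 𝓝 (0 : EuclideanSpace ℝ (Fin 3) × EuclideanSpace ℝ (Fin 3)),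
      (fderiv ℝ (anchorCoord ωC ωN ωX C₀ N₀) w).det ≠ 0 := hfd.eventually_ne hne
  obtain ⟨δ, hδ, hball⟩ := Metric.eventually_nhds_iff.1 hev
  refine ⟨min δ 1, lt_min hδ one_pos, min_le_right _ _, fun w hw => ?_⟩
  have hwδ : dist w 0 < δ := by rw [dist_zero_right]; exact lt_of_lt_of_le hw (min_le_left _ _)
  have hw2 : ‖w.2‖ < 1 := lt_of_le_of_lt (norm_snd_le w) (lt_of_lt_of_le hw (min_le_right _ _))
  exact ⟨hball hwδ, contDiffAt_anchorDensity hC hN hCN hX hC₀ hN₀ hw2 (hball hwδ)⟩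

end Anchors

end Summit.QuantumFields.YangMills.Theorems.VirialFluxGap.AnchorSlice

end
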